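import Summits.Schanuel.Schanuel.Theorems.RootDecomp1KArcCell04

/-!
# RootDecomp1KArcCell — lens 1, generation 50, node 9 «THE ARC ENGINE: separation by positive-dimensional containment; members ρ° = Π(1+4^(−k!)) and the twin σ° = Π(1+2·4^(−k!)); item 33364 decided hyp-free at zA = (1, ℓ₂, ρ°), zD = (1, ρ°, σ°) and π-twins» — continuation (RootDecomp1KArcCell05): §5 the arcs of ρ°: truncation-genericity by E2 + E1, tightness

(lens-1 g50 HOME kernel K = HOME/decomp-schanuel-lens-1/g50/ArcCell.lean 10f1e0d5…, 3410 l · 258 decl lines, imports …RootDecomp1KCollarWall05 + …RootDecomp1KCommonRadixCell04 + …RootDecomp1KNWMeasureHolds BY NAME; P ArcCellProbe.lean af7624ff… rc 0 / C₀ ArcCellCtrl0.lean d71f613e… rc 0 / C ArcCellCtrl.lean 242a3b02… rc 1 = 42 planted; memo NODE-g50.md; CLAIM L2466, EX-ANTE PRICE + CHECKLIST K-g50 L2467, NODE L2469 / REQUEST L2470 (with the lens's ex-post self-correction: both members fall to printed dominance in substance — zA directly by Bundschuh LNM 1415 p.78 / Zhu 推论 1.3.3, zD after τ = σ°/ρ°²);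 critic VERDICT L2473: CLEARED AS PRICED EX ANTE — ONE CELL ×1 «ARC CELL (TYPED-LEVEL)» with the SUBSTANCE CAVEAT OF RECORD (both members inside the archimedean dominance class in substance; E2 convenient, not necessary), RULE K-R39 FIXED, PORT GO. Port by census-1 gen 21 as `RootDecomp1KArcCell01–13` along K's §1–§12 with §4, §7 and §12 cut at decl boundaries by the 400-line file cap: 01 = §1 (E1) `aeval_one_div_two_pow_ne_zero` (dyadic root lemma) + §2 (E2) `toPolyPoly`, `arc_count` (a relation contains ≤ deg q of an injective family of rational arcs — roots over the domain ℚ[X]); 02 = §3 (A) the member: `dfac`, `arcNum`, `arcProdQ` (ρ°_N), `sQ`, `rhoArc` (ρ° = Π(1 + 4^(−k!))) and its tails; 03 = §4a (E3) `TruncGenericSeq` («[class] definition» tag) + **`algebraicIndependent_of_truncGenericSeq`** (the g36/g37 extraction re-plumbed to arbitrary dyadic-type schedules); 04 = §4b `psQ`, the link `truncGeneric_iff_truncGenericSeq` and the tree (X′) re-derived — K's `theorem algebraicIndependent_liouville_of_truncGeneric'` DEMOTED to a documented `example` (its statement is byte-identical to the tree's `RootDecomp1KCommonRadixCell.algebraicIndependent_liouville_of_truncGeneric`,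 CommonRadixCell03 l.98 — dedup twin flagged by the writer L2472 (α), demotion pre-sanctioned by the critic L2473; nothing in K uses the primed name); 05 = §5 the arcs of ρ°: `arcPoly`, `arcF`, `arcBasis`, `arcScal`, `clearArc`, `truncGenericSeq_arc`, tightness `qArc` / `qArc_tight`; 06 = §6 the arc cell `algebraicIndependent_arc_of_mvPolyMeasure`, `algebraicIndependent_rhoArc_ell2`, walls `sb_arcWall3(_pi)`, item-shape instances + §7 head `zA` / `zApi`, `linearIndependent_zA(pi)`, `linLiouville_zA(pi)`; 07 = §7a the ONE 2-adic cut `cutA` + **`form_lower_bound_A`** (exponent 9), `not_hyperLinLiouville_zA(pi)` (m₀ = 10), `sb_zA(pi)`, `finiteOrderLiouvilleSchanuel_at_zA(pi)`, `item33364_at_zA(pi)`, `item31077_at_zA`; 08 = §8 `rhoArc_position` (11 conjuncts by tree name) and its lemmas, `liouville_rhoArc`; 09 = §9 (A′) the twin σ° = Π(1 + 2·4^(−k!)): `arcNum2`, `arcOdd2`, `arcProdQ2`, `sigmaArc`, `liouville_sigmaArc`; 10 = §10 the lines of (ρ°, σ°): `linPoly`, `linF`, `linBasis`, `linScal`, `clearLin`,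 `truncGenericSeq_lin`, `qLin` / `qLin_tight`; 11 = §11 the twin cell `algebraicIndependent_twin_of_mvPolyMeasure`, walls `sb_twinWall3(_pi)`, item-shape instances + §12 head `zD` / `zDpi`, binders; 12 = §12a part 1 the archimedean two-level cut `cutD`, `cutD_succ_ne_zero`, `cutD_height_bound`; 13 = §12a part 2 **`form_lower_bound_D`** (exponent 7), `not_hyperLinLiouville_zD(pi)` (m₀ = 8), `sb_zD(pi)`, `item33364_at_zD(pi)`, `zD_shape`. PORT EDITS (census convention): `set_option linter.dupNamespace false` dropped; 77 one-line helper docstrings added (statements quoted); per-part private helper copies; sections `Extraction` / `Members` / `TwinMembers` closed and re-opened across the cuts with their `variable` / `open` lines; statements and proofs otherwise verbatim (no renames; K's own private markers kept). `--supports stmt-Schanuel-33364`; no census credit carried; rung 0 — nothing here proves Schanuel; no ∀-item moves; 33364, 33363, 31077 stay OPEN.)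
-/

noncomputable section

open Polynomial LiouvilleNumber
open scoped Nat

namespace Summit.Schanuel.Schanuel.Theorems.RootDecomp1KArcCell

open Summit.Schanuel.Schanuel.Theorems.RootDecomp1KCollarCell
open Summit.Schanuel.Schanuel.Theorems.RootDecomp1KGapCell
open Summit.Schanuel.Schanuel.Theorems.RootDecomp1KTwoBaseCell
open Summit.Schanuel.Schanuel.Theorems.RootDecomp1KRelLiouvilleCell
open Summit.Schanuel.Schanuel.Theorems.RootDecomp1KNWMeasureHolds (polyMeasure_exp_one_holds)
open Summit.Schanuel.Schanuel.Theorems.RootDecomp1KHyper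
open Summit.Schanuel.Schanuel.Theorems.RootDecomp1KHyper.HyperCell
open Summit.Schanuel.Schanuel.Theorems.RootDecomp1KCommonRadixCell (TruncGeneric algebraicIndependent_liouville_of_truncGeneric)

/-! ## §5  (A) THE ARCS OF `ρ°` — truncation-genericity of `((ρ°_N, s_N))_N` BY THE ARC ENGINE (E2 + E1)

The level points `P_N = (ρ°_N, s_N)` satisfy `P_N = (ρ°_{N-1}(1 + u_N²), s_{N-1} + u_N)`, `u_N = 2^{-N!}`: the point
`P_N` lies on the ARC `γ_{N-1} : T ↦ (ρ°_{N-1}(1 + T²), s_{N-1} + T)` (a parabola `X₀ = f_{N-1}(X₁)`), at the dyadic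
parameter `T = u_N`.  (E2) finds, in every window of `totalDegree q + 1` consecutive levels, an arc NOT contained in
`{q = 0}`; on it `q|_γ(T) ∈ ℚ[T]` is non-zero with dyadic coefficients of height `2^{O(d·(N-1)!)}` — BELOW the gap
`2^{N!}` — so (E1) forbids the root `T = u_N`.  ONE level CAN be contained (`qArc_tight` below): the window count is used. -/
section Arcs

/-- `q` restricted to the arc of stage `M` in the arc parameter `T`: `q(ρ°_M (1 + T²), s_M + T) ∈ ℚ[T]`. -/
def arcPoly (q : MvPolynomial (Fin 2) ℤ) (M : ℕ) : ℚ[X] :=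
  MvPolynomial.aeval
    (![Polynomial.C (arcProdQ M) * (1 + Polynomial.X ^ 2), Polynomial.C (sQ M) + Polynomial.X] : Fin 2 → ℚ[X]) q

/-- The arc of stage `M` as a graph over the abscissa `X₁`: `X₀ = f_M(X₁)`, `f_M = ρ°_M (1 + (X₁ − s_M)²)`. -/
def arcF (M : ℕ) : ℚ[X] :=
  Polynomial.C (arcProdQ M) * (1 + (Polynomial.X - Polynomial.C (sQ M)) ^ 2)

/-- `(m : ℕ) : ((1 : ℚ) / 2 ^ m) ^ 2 = 1 / 4 ^ m`. -/
theorem one_div_two_pow_sq (m : ℕ) : ((1 : ℚ) / 2 ^ m) ^ 2 = 1 / 4 ^ m := by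
  rw [div_pow, one_pow, ← pow_mul, show (4 : ℚ) = 2 ^ 2 by norm_num, ← pow_mul, mul_comm]

/-- THE LEVEL POINT LIES ON THE PRECEDING ARC: `(q|_{γ_M})(u_{M+1}) = q(ρ°_{M+1}, s_{M+1})`. -/
theorem arcPoly_eval (q : MvPolynomial (Fin 2) ℤ) (M : ℕ) :
    (arcPoly q M).eval (1 / 2 ^ (M + 1)!) = MvPolynomial.aeval ![arcProdQ (M + 1), sQ (M + 1)] q := by
  rw [arcPoly, ← Polynomial.coe_evalRingHom, map_aeval_int]
  have hw : (fun i => (evalRingHom ((1 : ℚ) / 2 ^ (M + 1)!))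
      ((![Polynomial.C (arcProdQ M) * (1 + Polynomial.X ^ 2), Polynomial.C (sQ M) + Polynomial.X] :
        Fin 2 → ℚ[X]) i)) = ![arcProdQ (M + 1), sQ (M + 1)] := by
    funext i
    fin_cases i
    · show Polynomial.eval ((1 : ℚ) / 2 ^ (M + 1)!) (Polynomial.C (arcProdQ M) * (1 + Polynomial.X ^ 2)) =
        arcProdQ (M + 1)
      rw [eval_mul, eval_C, eval_add, eval_one, eval_pow, eval_X, one_div_two_pow_sq, arcProdQ_succ]
    · show Polynomial.eval ((1 : ℚ) / 2 ^ (M + 1)!) (Polynomial.C (sQ M) + Polynomial.X) = sQ (M + 1)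
      rw [eval_add, eval_C, eval_X, sQ_succ]
  rw [hw]

/-- CONTAINMENT TRANSFERS TO THE GRAPH FORM: `q(f_M(X), X) = (q|_{γ_M}) ∘ (X − s_M)`. -/
theorem aeval_arcF_eq_comp (q : MvPolynomial (Fin 2) ℤ) (M : ℕ) :
    MvPolynomial.aeval ![arcF M, Polynomial.X] q = (arcPoly q M).comp (Polynomial.X - Polynomial.C (sQ M)) := by
  rw [arcPoly, ← Polynomial.coe_compRingHom_apply, map_aeval_int]
  have hw : (fun i => (Polynomial.compRingHom (Polynomial.X - Polynomial.C (sQ M)))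
      ((![Polynomial.C (arcProdQ M) * (1 + Polynomial.X ^ 2), Polynomial.C (sQ M) + Polynomial.X] :
        Fin 2 → ℚ[X]) i)) = ![arcF M, Polynomial.X] := by
    funext i
    fin_cases i
    · show (Polynomial.C (arcProdQ M) * (1 + Polynomial.X ^ 2)).comp (Polynomial.X - Polynomial.C (sQ M)) =
        arcF M
      rw [arcF, mul_comp, C_comp, add_comp, one_comp, pow_comp, X_comp]
    · show (Polynomial.C (sQ M) + Polynomial.X).comp (Polynomial.X - Polynomial.C (sQ M)) = Polynomial.X
      rw [add_comp, C_comp, X_comp]; ring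
  rw [hw]

/-- If the arc polynomial `arcPoly q M` vanishes identically then `q` vanishes on the arc `(arcF M, X)` in `ℚ[X]`. -/
theorem aeval_arcF_eq_zero_of_arcPoly {q : MvPolynomial (Fin 2) ℤ} {M : ℕ} (h : arcPoly q M = 0) :
    MvPolynomial.aeval ![arcF M, Polynomial.X] q = 0 := by
  rw [aeval_arcF_eq_comp, h, zero_comp]

/-- `(M : ℕ) : (arcF M).eval (sQ M) = arcProdQ M`. -/
theorem arcF_eval_sQ (M : ℕ) : (arcF M).eval (sQ M) = arcProdQ M := by
  simp [arcF]

/-- `(M : ℕ) (x : ℚ) : arcProdQ M ≤ (arcF M).eval x`. -/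
theorem arcProdQ_le_arcF_eval (M : ℕ) (x : ℚ) : arcProdQ M ≤ (arcF M).eval x := by
  have h : (arcF M).eval x = arcProdQ M * (1 + (x - sQ M) ^ 2) := by simp [arcF]
  rw [h]
  have := arcProdQ_pos M
  nlinarith [sq_nonneg (x - sQ M)]

/-- THE ARCS ARE PAIRWISE DISTINCT (their minima `ρ°_M` increase strictly). -/
theorem arcF_injective : Function.Injective arcF := by
  intro M M' h
  by_contra hne
  rcases lt_or_gt_of_ne hne with hlt | hlt
  · have h1 := arcProdQ_le_arcF_eval M' (sQ M)
    rw [← h, arcF_eval_sQ] at h1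
    exact absurd (arcProdQ_strictMono hlt) (not_lt.mpr h1)
  · have h1 := arcProdQ_le_arcF_eval M (sQ M')
    rw [h, arcF_eval_sQ] at h1
    exact absurd (arcProdQ_strictMono hlt) (not_lt.mpr h1)

/-- The arc basis polynomials `(1 + T²)^{e₀} (p + b·T)^{e₁}` with NATURAL coefficients. -/
def arcBasis (p b e₀ e₁ : ℕ) : Polynomial ℕ :=
  (1 + Polynomial.X ^ 2) ^ e₀ * (Polynomial.C p + Polynomial.C b * Polynomial.X) ^ e₁

/-- For natural coefficients every coefficient is at most the value at `1`. -/
private theorem coeff_le_eval_one (B : Polynomial ℕ) (j : ℕ) : B.coeff j ≤ B.eval 1 := by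
  rw [Polynomial.eval_eq_sum, Polynomial.sum_def]
  simp only [one_pow, mul_one]
  by_cases hj : B.coeff j = 0
  · rw [hj]; exact Nat.zero_le _
  · exact Finset.single_le_sum (f := fun i => B.coeff i) (fun _ _ => Nat.zero_le _)
      (Polynomial.mem_support_iff.mpr hj)

/-- `(p b e₀ e₁ : ℕ) : (arcBasis p b e₀ e₁).eval 1 = 2 ^ e₀ * (p + b) ^ e₁`. -/
theorem arcBasis_eval_one (p b e₀ e₁ : ℕ) : (arcBasis p b e₀ e₁).eval 1 = 2 ^ e₀ * (p + b) ^ e₁ := by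
  simp [arcBasis, one_add_one_eq_two]

/-- The arc scalars `r^{e₀} a^{d−e₀} b^{d−e₁}`. -/
def arcScal (d r a b : ℕ) (e : Fin 2 →₀ ℕ) : ℕ := r ^ e 0 * a ^ (d - e 0) * b ^ (d - e 1)

/-- THE CLEARED RESTRICTION `(a b)^d · q(r/a·(1 + T²), p/b + T) ∈ ℤ[T]`, written on the arc basis
(`map_clearArc`). -/
def clearArc (q : MvPolynomial (Fin 2) ℤ) (d r a p b : ℕ) : ℤ[X] :=
  ∑ e ∈ q.support, Polynomial.C (q.coeff e * (arcScal d r a b e : ℤ)) *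
    Polynomial.map (Nat.castRingHom ℤ) (arcBasis p b (e 0) (e 1))

/-- The basis polynomial `arcBasis p b e₀ e₁` mapped to `ℚ[X]` is `(1 + X²)^{e₀} · (p + b·X)^{e₁}` (up to the casts). -/
theorem map_arcBasis (p b e₀ e₁ : ℕ) :
    (Polynomial.map (Nat.castRingHom ℤ) (arcBasis p b e₀ e₁)).map (Int.castRingHom ℚ) =
      (1 + Polynomial.X ^ 2) ^ e₀ * (Polynomial.C (p : ℚ) + Polynomial.C (b : ℚ) * Polynomial.X) ^ e₁ := by
  rw [Polynomial.map_map, Subsingleton.elim ((Int.castRingHom ℚ).comp (Nat.castRingHom ℤ)) (Nat.castRingHom ℚ),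
    arcBasis]
  simp [Polynomial.map_pow, Polynomial.map_mul]

/-- `clearArc` IS the cleared restriction: over `ℚ`, `clearArc = (a b)^d · q(ρ (1 + T²), s + T)` when `r = ρ a`,
`p = s b` and `d` bounds the partial degrees. -/
theorem map_clearArc (q : MvPolynomial (Fin 2) ℤ) {d r a p b : ℕ} {ρ s : ℚ} (hr : (r : ℚ) = ρ * a)
    (hp : (p : ℚ) = s * b) (hdeg : ∀ e ∈ q.support, e 0 ≤ d ∧ e 1 ≤ d) :
    (clearArc q d r a p b).map (Int.castRingHom ℚ) =
      Polynomial.C (((a : ℚ) * b) ^ d) *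
        MvPolynomial.aeval
          (![Polynomial.C ρ * (1 + Polynomial.X ^ 2), Polynomial.C s + Polynomial.X] : Fin 2 → ℚ[X]) q := by
  classical
  rw [clearArc, Polynomial.map_sum, MvPolynomial.aeval_def, MvPolynomial.eval₂_eq', Finset.mul_sum]
  refine Finset.sum_congr rfl fun e he => ?_
  obtain ⟨h0, h1⟩ := hdeg e he
  obtain ⟨t0, ht0⟩ := Nat.exists_eq_add_of_le h0
  obtain ⟨t1, ht1⟩ := Nat.exists_eq_add_of_le h1
  have hs0 : d - e 0 = t0 := by omega
  have hs1 : d - e 1 = t1 := by omega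
  rw [Polynomial.map_mul, Polynomial.map_C, map_arcBasis, Fin.prod_univ_two, arcScal, hs0, hs1]
  simp only [Matrix.cons_val_zero, Matrix.cons_val_one, eq_intCast, ← Polynomial.C_eq_intCast]
  push_cast
  have hab : ((a : ℚ) * b) ^ d = ((a : ℚ) ^ e 0 * (a : ℚ) ^ t0) * ((b : ℚ) ^ e 1 * (b : ℚ) ^ t1) := by
    rw [mul_pow, ← pow_add, ← pow_add, ← ht0, ← ht1]
  rw [hab, hr, hp]
  have e5 : Polynomial.C (s * (b : ℚ)) + Polynomial.C (b : ℚ) * Polynomial.X =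
      Polynomial.C (b : ℚ) * (Polynomial.C s + Polynomial.X) := by
    rw [Polynomial.C_mul]; ring
  rw [e5]
  simp only [Polynomial.C_mul, Polynomial.C_pow, mul_pow]
  ring

/-- COEFFICIENT BOUND for the cleared restriction: `|coeff_j| ≤ L(q) · 8^d a^d b^d` when `r ≤ 4a`, `p ≤ 3b` and
`d` bounds the total degree. -/
theorem abs_coeff_clearArc_le (q : MvPolynomial (Fin 2) ℤ) {d r a p b : ℕ} (hr : r ≤ 4 * a) (hpb : p ≤ 3 * b)
    (hdeg : ∀ e ∈ q.support, e 0 + e 1 ≤ d) (j : ℕ) :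
    |(clearArc q d r a p b).coeff j| ≤ mvlen q * ((8 : ℤ) ^ d * (a : ℤ) ^ d * (b : ℤ) ^ d) := by
  classical
  rw [clearArc, Polynomial.finsetSum_coeff]
  refine (Finset.abs_sum_le_sum_abs _ _).trans ?_
  rw [mvlen, Finset.sum_mul]
  refine Finset.sum_le_sum fun e he => ?_
  rw [Polynomial.coeff_C_mul, Polynomial.coeff_map, abs_mul, abs_mul]
  have hed := hdeg e he
  -- the natural-number inequality `arcScal · coeff_j(arcBasis) ≤ 8^d a^d b^d`
  have hB : (arcBasis p b (e 0) (e 1)).coeff j ≤ 2 ^ e 0 * (p + b) ^ e 1 := by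
    rw [← arcBasis_eval_one]; exact coeff_le_eval_one _ j
  have hnat : arcScal d r a b e * (arcBasis p b (e 0) (e 1)).coeff j ≤ 8 ^ d * a ^ d * b ^ d := by
    obtain ⟨t0, ht0⟩ := Nat.exists_eq_add_of_le (show e 0 ≤ d by omega)
    obtain ⟨t1, ht1⟩ := Nat.exists_eq_add_of_le (show e 1 ≤ d by omega)
    have hs0 : d - e 0 = t0 := by omega
    have hs1 : d - e 1 = t1 := by omega
    have h1 : r ^ e 0 ≤ (4 * a) ^ e 0 := Nat.pow_le_pow_left hr _
    have h2 : (p + b) ^ e 1 ≤ (4 * b) ^ e 1 := Nat.pow_le_pow_left (by omega) _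
    have h3 : (4 : ℕ) ^ e 1 ≤ 8 ^ e 1 := Nat.pow_le_pow_left (by norm_num) _
    have h4 : (8 : ℕ) ^ (e 0 + e 1) ≤ 8 ^ d := Nat.pow_le_pow_right (by norm_num) hed
    calc arcScal d r a b e * (arcBasis p b (e 0) (e 1)).coeff j
        ≤ (r ^ e 0 * a ^ (d - e 0) * b ^ (d - e 1)) * (2 ^ e 0 * (p + b) ^ e 1) :=
          Nat.mul_le_mul_left _ hB
      _ ≤ ((4 * a) ^ e 0 * a ^ t0 * b ^ t1) * (2 ^ e 0 * (4 * b) ^ e 1) := by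
          rw [hs0, hs1]; gcongr
      _ = (4 ^ e 0 * 2 ^ e 0) * 4 ^ e 1 * (a ^ e 0 * a ^ t0) * (b ^ e 1 * b ^ t1) := by
          rw [mul_pow, mul_pow]; ring
      _ = 8 ^ e 0 * 4 ^ e 1 * a ^ d * b ^ d := by
          rw [← mul_pow, ← pow_add, ← pow_add, ← ht0, ← ht1]; norm_num
      _ ≤ 8 ^ e 0 * 8 ^ e 1 * a ^ d * b ^ d := by gcongr
      _ = 8 ^ (e 0 + e 1) * a ^ d * b ^ d := by rw [← pow_add]
      _ ≤ 8 ^ d * a ^ d * b ^ d := by gcongr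
  have hcast : ((arcScal d r a b e : ℕ) : ℤ) * ((arcBasis p b (e 0) (e 1)).coeff j : ℤ) ≤
      (8 : ℤ) ^ d * (a : ℤ) ^ d * (b : ℤ) ^ d := by exact_mod_cast hnat
  have hnn1 : (0 : ℤ) ≤ (arcScal d r a b e : ℕ) := by positivity
  have hnn2 : (0 : ℤ) ≤ ((arcBasis p b (e 0) (e 1)).coeff j : ℕ) := by positivity
  simp only [Nat.coe_castRingHom]
  rw [abs_of_nonneg hnn1, abs_of_nonneg hnn2, mul_assoc]
  exact mul_le_mul_of_nonneg_left hcast (abs_nonneg _)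

/-- THE THRESHOLD: beyond `M ≥ 8d + L` the coefficient bound `L · 2^{3d + 2d·D_M + d·M!}` is BELOW the gap `2^{(M+1)!}`
(uses `D_M ≤ 2·M!`; no numeral is evaluated). -/
theorem arc_threshold {d L M : ℕ} (hM : 8 * d + L ≤ M) :
    L * 2 ^ (3 * d + 2 * d * dfac M + d * M !) < 2 ^ (M + 1)! := by
  have hD := dfac_le M
  have hf : 1 ≤ M ! := Nat.factorial_pos M
  have hexp : 3 * d + 2 * d * dfac M + d * M ! + (L + 1) ≤ (M + 1)! := by
    rw [Nat.factorial_succ]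
    have h1 : 2 * d * dfac M ≤ 2 * d * (2 * M !) := Nat.mul_le_mul_left _ hD
    have h2 : 3 * d ≤ 3 * d * M ! := Nat.le_mul_of_pos_right _ hf
    have h3 : L + 1 ≤ (L + 1) * M ! := Nat.le_mul_of_pos_right _ hf
    have h4 : (8 * d + L + 1) * M ! ≤ (M + 1) * M ! := Nat.mul_le_mul_right _ (by omega)
    have e4 : (8 * d + L + 1) * M ! = 3 * d * M ! + 2 * d * (2 * M !) + d * M ! + (L + 1) * M ! := by ring
    omega
  have hL : L < 2 ^ (L + 1) :=
    Nat.lt_two_pow_self.trans (Nat.pow_lt_pow_right (by norm_num) (by omega))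
  calc L * 2 ^ (3 * d + 2 * d * dfac M + d * M !)
      < 2 ^ (L + 1) * 2 ^ (3 * d + 2 * d * dfac M + d * M !) :=
        Nat.mul_lt_mul_of_pos_right hL (pow_pos (by norm_num) _)
    _ = 2 ^ (3 * d + 2 * d * dfac M + d * M ! + (L + 1)) := by rw [← pow_add, add_comm]
    _ ≤ 2 ^ (M + 1)! := Nat.pow_le_pow_right (by norm_num) hexp

/-- **THE ARC ENGINE AT THE MEMBER: `((ρ°_N, s_N))_N` IS TRUNCATION-GENERIC.**  For `q ≠ 0` of total degree `d` and
length `L`: (E2) gives a stage `M` in the window `[max N₀ (8d + L), … + d]` whose arc `γ_M` is not contained in `{q = 0}`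
(the arcs are pairwise distinct, `arcF_injective`); the cleared restriction `clearArc ∈ ℤ[T]` is then non-zero with
`|coeff| ≤ L · 8^d (4^{D_M})^d (2^{M!})^d < 2^{(M+1)!}` (`arc_threshold`), so (E1) forbids its root `T = u_{M+1} =
2^{-(M+1)!}`, i.e. `q(ρ°_{M+1}, s_{M+1}) ≠ 0` (`arcPoly_eval`). -/
theorem truncGenericSeq_arc : TruncGenericSeq ![arcProdQ, sQ] := by
  classical
  intro q hq N₀
  set d : ℕ := q.totalDegree with hd
  have hLnn : 0 ≤ mvlen q := mvlen_nonneg q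
  set L : ℕ := (mvlen q).toNat with hL
  have hLz : (L : ℤ) = mvlen q := by rw [hL]; exact Int.toNat_of_nonneg hLnn
  obtain ⟨M, hM₁, -, hgood⟩ := arc_count hq arcF_injective (max N₀ (8 * d + L))
  have hMN : N₀ ≤ M := le_trans (le_max_left _ _) hM₁
  have hMd : 8 * d + L ≤ M := le_trans (le_max_right _ _) hM₁
  have hP : arcPoly q M ≠ 0 := fun h => hgood (aeval_arcF_eq_zero_of_arcPoly h)
  refine ⟨M + 1, by omega, ?_⟩
  -- degrees
  have hdeg : ∀ e ∈ q.support, e 0 + e 1 ≤ d := fun e he => by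
    have h1 := MvPolynomial.le_totalDegree he
    rwa [Finsupp.sum_fintype _ _ (fun _ => rfl), Fin.sum_univ_two] at h1
  have hdeg' : ∀ e ∈ q.support, e 0 ≤ d ∧ e 1 ≤ d := fun e he => by have := hdeg e he; omega
  -- the data of the arc `γ_M`
  set a : ℕ := 4 ^ dfac M with ha
  set b : ℕ := 2 ^ M ! with hb
  set r : ℕ := arcNum M with hr
  set p : ℕ := psNumer 2 M with hp
  have hapos : (0 : ℚ) < a := by rw [ha]; positivity
  have hbpos : (0 : ℚ) < b := by rw [hb]; positivity
  have hrq : (r : ℚ) = arcProdQ M * a := by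
    rw [hr, ha, ← arcProdQ_mul_den M]; push_cast; rfl
  have hpq : (p : ℚ) = sQ M * b := by
    rw [hp, hb, ← sQ_mul_den M]; push_cast; rfl
  have hr4 : r ≤ 4 * a := by
    have h3 := arcProdQ_lt_three' M
    have h : (r : ℚ) ≤ 4 * a := by rw [hrq]; nlinarith
    exact_mod_cast h
  have hp3 : p ≤ 3 * b := by
    have h2 := sQ_lt_two M
    have h : (p : ℚ) ≤ 3 * b := by rw [hpq]; nlinarith
    exact_mod_cast h
  -- the cleared restriction and its image over `ℚ`
  set Acl : ℤ[X] := clearArc q d r a p b with hAcl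
  have hmap : Acl.map (Int.castRingHom ℚ) = Polynomial.C (((a : ℚ) * b) ^ d) * arcPoly q M :=
    map_clearArc q hrq hpq hdeg'
  have hab0 : Polynomial.C (((a : ℚ) * b) ^ d) ≠ 0 := by
    rw [Ne, Polynomial.C_eq_zero]; positivity
  have hA0 : Acl ≠ 0 := by
    intro h0
    apply hP
    have h1 : Polynomial.C (((a : ℚ) * b) ^ d) * arcPoly q M = 0 := by rw [← hmap, h0, Polynomial.map_zero]
    rcases mul_eq_zero.mp h1 with h | h
    · exact absurd h hab0
    · exact h
  -- the coefficient bound is BELOW the gap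
  have hcoef : ∀ j, |Acl.coeff j| < 2 ^ (M + 1)! := fun j => by
    refine lt_of_le_of_lt (abs_coeff_clearArc_le q hr4 hp3 hdeg j) ?_
    have e8 : (8 : ℤ) ^ d * (a : ℤ) ^ d * (b : ℤ) ^ d = 2 ^ (3 * d + 2 * d * dfac M + d * M !) := by
      rw [ha, hb]; push_cast
      rw [show (8 : ℤ) = 2 ^ 3 by norm_num, show (4 : ℤ) = 2 ^ 2 by norm_num]
      rw [← pow_mul, ← pow_mul, ← pow_mul, ← pow_mul, ← pow_add, ← pow_add]
      congr 1; ring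
    rw [e8, ← hLz]
    exact_mod_cast arc_threshold hMd
  -- (E1): the dyadic point `u_{M+1}` is not a root of the cleared restriction
  have hne := aeval_one_div_two_pow_ne_zero hA0 hcoef
  intro h0
  apply hne
  have hx : (fun i => (![arcProdQ, sQ] : Fin 2 → ℕ → ℚ) i (M + 1)) = ![arcProdQ (M + 1), sQ (M + 1)] := by
    funext i; fin_cases i <;> rfl
  rw [hx] at h0
  rw [Polynomial.aeval_def, Polynomial.eval₂_eq_eval_map, algebraMap_int_eq, hmap, Polynomial.eval_mul,
    Polynomial.eval_C, arcPoly_eval, h0, mul_zero]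

/-- **TIGHTNESS — ONE LEVEL CAN BE CONTAINED.**  The cleared equation of the arc `γ_0` (`ρ°_0 = 5/4`, `s_0 = 1/2`):
`qArc = 16·X₀ − 5·(4 + (2X₁ − 1)²) ∈ ℤ[X₀, X₁]`. -/
def qArc : MvPolynomial (Fin 2) ℤ :=
  16 * MvPolynomial.X 0 - 5 * (4 + (2 * MvPolynomial.X 1 - 1) ^ 2)

/-- `sQ 0 = 1 / 2`. -/
theorem sQ_zero : sQ 0 = 1 / 2 := by
  rw [sQ]; simp [psNumer]

/-- `qArc ≠ 0` (its value at the origin is `-25`) and the whole arc `γ_0` lies in `{qArc = 0}`: a single level point CAN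
lie on a curve through the preceding arc, so (E1) ALONE decides nothing there and the WINDOW COUNT (E2) is used. -/
theorem qArc_tight : qArc ≠ 0 ∧ arcPoly qArc 0 = 0 := by
  constructor
  · intro h
    have h1 := congrArg (MvPolynomial.eval (fun _ : Fin 2 => (1 : ℤ))) h
    simp [qArc] at h1
  · rw [arcPoly, qArc, arcProdQ_zero, sQ_zero]
    simp only [map_sub, map_mul, map_pow, map_add, map_ofNat, map_one, MvPolynomial.aeval_X,
      Matrix.cons_val_zero, Matrix.cons_val_one]
    have e1 : (16 : ℚ[X]) = Polynomial.C 16 := rfl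
    have e2 : (5 : ℚ[X]) = Polynomial.C 5 := rfl
    have e3 : (4 : ℚ[X]) = Polynomial.C 4 := rfl
    have e4 : (2 : ℚ[X]) = Polynomial.C 2 := rfl
    rw [e1, e2, e3, e4]
    have e5 : Polynomial.C (2 : ℚ) * (Polynomial.C (1 / 2) + Polynomial.X) - 1 = Polynomial.C 2 * Polynomial.X := by
      rw [mul_add, ← Polynomial.C_mul, show (2 : ℚ) * (1 / 2) = 1 by norm_num, Polynomial.C_1]; ring
    rw [e5, ← mul_assoc, ← Polynomial.C_mul, show (16 : ℚ) * (5 / 4) = 20 by norm_num]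
    have e6 : (Polynomial.C (2 : ℚ) * Polynomial.X) ^ 2 = Polynomial.C 4 * Polynomial.X ^ 2 := by
      rw [mul_pow, ← Polynomial.C_pow]; norm_num
    rw [e6, show (20 : ℚ) = 5 * 4 by norm_num, Polynomial.C_mul]
    ring

/-- The level point `P_1 = (25/16, 1)` indeed lies on `{qArc = 0}` (one contained level, by `arcPoly_eval`). -/
theorem qArc_level_one : MvPolynomial.aeval ![arcProdQ 1, sQ 1] qArc = 0 := by
  rw [← arcPoly_eval, qArc_tight.2, Polynomial.eval_zero]

end Arcs

end Summit.Schanuel.Schanuel.Theorems.RootDecomp1KArcCell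

end
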